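import Summits.QuantumFields.YangMills.Theorems.BalabanUVNodesK0V23Stub3Sockets
import Summits.QuantumFields.YangMills.Theorems.BalabanUVNodesN09BackgroundRadiiTransfer

/-!
# Sketch — crux-ideate round 2, seat -3 (provocation `negation`, residue ρ1 = dictionary U9), crux `stmt-QuantumFields-20541`
(`BalabanUVNodes.Record13SepCoPHInhabited`, skeleton V23, open stub 2′ `stub_absBetaBoxAtThm1WitnessCCMGenGridGZB13`).

HONEST FRAMING: finite-volume ∕ conditional bookkeeping about ONE stub of ONE route; NODE O = [RG-I] Thm 3 β-clause p.264 is print-proved (claimed),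
unported; dictionary U9 open; [RG-I] Thm 2 (0.31) unpublished and off this road; the Yang–Mills mass gap is NOT proved by anything here.

WHAT IS HERE (kernel-checked unless `stub_`):
* §1 CHOICE RIGIDITY (L1, L2, L2u — proved): the background selector of record `Uk F N K k ε V` (a `Classical.choose` over the predicate
  `IsBackground (avOfRecord F N K) (bgReg F N K k ε) k V`) is a FUNCTION OF THAT PREDICATE: two radii whose minimiser predicates are extensionally
  equal select THE SAME configuration (not merely the same orbit); and (8)-membership of every radius-`ε′` minimiser in the class `ε ≤ ε′` plus
  solvability at `ε′` makes the predicates equal.  No uniqueness (6), no covariance binder.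
* §2 the two [15] antecedents of 2′ are ANTITONE in the radius letter `a₀` (proved: `a₀` enters only as `ε₀ ≤ a₀`).
* §3 the NODE: 2′ ⟸ (W) «box owed at radii ≤ ā, with a certificate on the produced ε₂₉» ∧ (T) «β₁₃(F; a₀, ε₂₉) = β₁₃(F; ā, ε₂₉) above ā under the
  certificate» — composed BY NAME to `K0V23Defs.AbsBetaBoxAtThm1WitnessCCMGenGridGZBAt F` through the tree's uniform core (proved, no sorry).
* §4 the two registered idea stubs (sorry): `stub_beta13_radiusBlind` (card radius-collapse-choice-rigid-k0) and `stub_fluctDev_b0_le_on_fibre`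
  (card near-sheet-rider-k0).
-/

namespace Summit.QuantumFields.YangMills.Cruxes.Record13SepCoPHInhabited.RadiusCollapse

open Literature.MathematicalPhysics.QuantumFieldTheory.Balaban1983to89
open Literature.MathematicalPhysics.QuantumFieldTheory.Balaban1983to89.Node00
open Literature.MathematicalPhysics.QuantumFieldTheory.Balaban1983to89.T4Continuum (T4Family)
open Literature.MathematicalPhysics.QuantumFieldTheory.Balaban1983to89.FlowStep (BetaLowerH BetaUpperH HBeta)
open Summit.QuantumFields.YangMills.Theorems.K0V23Stub3Sockets
open Summit.QuantumFields.YangMills.BalabanUVNodes.N09BackgroundRadiiTransfer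
open Summit.QuantumFields.YangMills.Theorems.K0V23Defs

/-! ## §1  Choice rigidity of the background selector of record -/

section ChoiceRigidity

variable {F : T4Family} {N : ℕ} [NeZero N] {K k : ℕ} {ε ε' : ℝ} {V : GaugeField (F.P K) k (SU N)}

/-- **L1 — CHOICE RIGIDITY.**  If the minimiser predicates of (0.21) at radii `ε`, `ε′` agree extensionally at `V`, the selectors of record pick THE SAME
configuration: `U_k(ε; V) = U_k(ε′; V)` (both are `Classical.choose` of the same predicate, or both the junk default). -/
theorem Uk_eq_of_forall_isBackground_iff
    (h : ∀ U₀, IsBackground (avOfRecord F N K) (bgReg F N K k ε) k V U₀ ↔ IsBackground (avOfRecord F N K) (bgReg F N K k ε') k V U₀) :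
    Uk F N K k ε V = Uk F N K k ε' V := by
  have hP : (fun U₀ => IsBackground (avOfRecord F N K) (bgReg F N K k ε) k V U₀) =
      (fun U₀ => IsBackground (avOfRecord F N K) (bgReg F N K k ε') k V U₀) := funext fun U₀ => propext (h U₀)
  have key : ∀ (P P' : GaugeField (F.P K) 0 (SU N) → Prop), P = P' →
      ∀ (h₁ : ∃ x, P x) (h₂ : ∃ x, P' x), Classical.choose h₁ = Classical.choose h₂ := by
    rintro P _ rfl h₁ h₂
    rfl
  by_cases hex : UkExists F N K k ε V
  · have hex' : UkExists F N K k ε' V := by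
      obtain ⟨U₀, h₀⟩ := hex
      exact ⟨U₀, (h U₀).1 h₀⟩
    rw [Uk_eq_choose hex, Uk_eq_choose hex']
    exact key _ _ hP hex hex'
  · have hex' : ¬ UkExists F N K k ε' V := fun ⟨U₀, h₀⟩ => hex ⟨U₀, (h U₀).2 h₀⟩
    rw [Uk_of_not hex, Uk_of_not hex']

/-- **L2 — (8)-MEMBERSHIP + SOLVABILITY ⇒ SAME SELECTION.**  `ε ≤ ε′`, the radius-`ε′` problem solvable at `V`, and EVERY radius-`ε′` minimiser `ε`-regular
([15] Thm 1 (8) as print states it, for all minimisers) ⇒ `U_k(ε; V) = U_k(ε′; V)`.  (Mutual minimality, n09's two one-liners; no uniqueness (6).) -/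
theorem Uk_eq_of_le_of_forall_isBackground_mem (hle : ε ≤ ε') (hex : UkExists F N K k ε' V)
    (hreg : ∀ U₁, IsBackground (avOfRecord F N K) (bgReg F N K k ε') k V U₁ → U₁ ∈ bgReg F N K k ε) :
    Uk F N K k ε V = Uk F N K k ε' V :=
  Uk_eq_of_forall_isBackground_iff fun U₀ =>
    ⟨fun h₀ => isBackground_superset_of_exists_mem h₀ (bgReg_mono hle) (isBackground_Uk hex) (hreg _ (isBackground_Uk hex)),
     fun h₁ => isBackground_of_le_of_mem hle h₁ (hreg _ h₁)⟩

/-- **L2u — the n09 binder shape**: uniqueness of the radius-`ε′` orbit and `ε`-regularity of the ONE selected minimiser suffice. -/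
theorem Uk_eq_of_le_of_unique_of_Uk_mem (hle : ε ≤ ε') (hex : UkExists F N K k ε' V) (hu : UniqueUkOrbit F N K k ε' V)
    (hreg : Uk F N K k ε' V ∈ bgReg F N K k ε) : Uk F N K k ε V = Uk F N K k ε' V :=
  Uk_eq_of_le_of_forall_isBackground_mem hle hex fun U₁ h₁ =>
    (mem_bgReg_iff_of_orbitRel (hu _ _ (isBackground_Uk hex) h₁)).1 hreg

variable (F N) in
/-- The selectors of record at radii `a`, `a′` AGREE on the `r`-regular fields of every level of every torus. -/
def SelectorsAgreeOn (a a' r : ℝ) : Prop :=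
  ∀ (K k : ℕ) (V : GaugeField (F.P K) k (SU N)), PlaqSmall r V → Uk F N K k a V = Uk F N K k a' V

/-- (8)-membership for all minimisers + solvability at the larger radius, on the `r`-regular fields ⇒ the selectors agree there. -/
theorem selectorsAgreeOn_of_reg8 {a a' r : ℝ} (hle : a ≤ a')
    (hex : ∀ (K k : ℕ) (V : GaugeField (F.P K) k (SU N)), PlaqSmall r V → UkExists F N K k a' V)
    (h8 : ∀ (K k : ℕ) (V : GaugeField (F.P K) k (SU N)), PlaqSmall r V →
      ∀ U₁, IsBackground (avOfRecord F N K) (bgReg F N K k a') k V U₁ → U₁ ∈ bgReg F N K k a) :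
    SelectorsAgreeOn F N a a' r :=
  fun K k V hV => Uk_eq_of_le_of_forall_isBackground_mem hle (hex K k V hV) (h8 K k V hV)

/-- `SelectorsAgreeOn` is symmetric (bookkeeping). -/
theorem SelectorsAgreeOn.symm {a a' r : ℝ} (h : SelectorsAgreeOn F N a a' r) : SelectorsAgreeOn F N a' a r :=
  fun K k V hV => (h K k V hV).symm

end ChoiceRigidity

/-! ## §2  The two [15] antecedents of 2′ are antitone in the radius letter -/

section Antitone

variable {F : T4Family} {N : ℕ} [NeZero N]
  {Sup : (ν : Stage7Numerics) → (K : ℕ) → (ℕ → Set (Site (F.P K) 0)) → Set (Site (F.P K) 0)} {Adm : StepGuard F} {bd : BondDatum F}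
  {Dat : TopData F N} {M : ℕ} {B₃ B₃' a a' a₁ : ℝ}

theorem variationalThm1RegSepTop7MGB_anti (hle : a ≤ a') (h : VariationalThm1RegSepTop7MGB F N Sup Adm bd Dat B₃ a' a₁) :
    VariationalThm1RegSepTop7MGB F N Sup Adm bd Dat B₃ a a₁ :=
  fun ν M g K k s hs hM hA ε₀ δ h₁ h₂ h₃ hε => h ν M g K k s hs hM hA ε₀ δ h₁ h₂ h₃ (hε.trans hle)

theorem variationalThm1RegSepCoP7MGB_anti (hle : a ≤ a') (h : VariationalThm1RegSepCoP7MGB F N Adm bd Dat B₃ a' a₁) :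
    VariationalThm1RegSepCoP7MGB F N Adm bd Dat B₃ a a₁ :=
  variationalThm1RegSepTop7MGB_anti hle h

theorem gauge9RegSepTopStepGB_anti (hle : a ≤ a') (h : Gauge9RegSepTopStepGB F N Sup M Adm bd Dat B₃ B₃' a' a₁) :
    Gauge9RegSepTopStepGB F N Sup M Adm bd Dat B₃ B₃' a a₁ :=
  fun ν g K k s hs hM hA hk ε₀ δ h₁ h₂ h₃ hε => h ν g K k s hs hM hA hk ε₀ δ h₁ h₂ h₃ (hε.trans hle)

end Antitone

/-! ## §3  The NODE: 2′ ⟸ (box owed below ā) ∧ (radius blindness above ā), through the uniform core -/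

section Node

variable (F : T4Family)

/-- The two [15] antecedents of 2′ at radius `a₀` (the ∃-blob of the uniform core `absBetaBoxGZBAt_iff_uniformZB`, verbatim). -/
def AnteZB (a₀ : ℝ) : Prop :=
  ∃ (j c c₀ c₁ : ℕ) (B₃ B₃' a₁ : ℝ), c ≤ F.L ^ j ∧ c₀ ≤ j + 1 ∧ c₁ ≤ j ∧ 2 * (F.L : ℝ) ^ 2 ≤ B₃ ∧ 0 < B₃' ∧ 0 < a₁ ∧
    VariationalThm1RegSepCoP7MGB F 2
      (fun ν M g K k _s => c ≤ ν.M₁ ∧ k + c₀ ≤ F.m + K ∧ F.L ^ c₁ ∣ M ∧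
        ∀ i, 1 ≤ i → i ≤ k → dCubeSide (F.P K).L M (RkOfRecord (F.P K).L ν.r (g i)) i ∣ (F.P K).sitesPerDir 0) (lamDatum F) (dataSmall7LamTopOf F 2) B₃ a₀ a₁ ∧
    Gauge9RegSepTopStepGB F 2 (fun ν K Ω => suppDomOfRecord F ν K Ω) (F.L ^ j)
      (fun ν M g K k _s => c ≤ ν.M₁ ∧ k + c₀ ≤ F.m + K ∧ F.L ^ c₁ ∣ M ∧
        ∀ i, 1 ≤ i → i ≤ k → dCubeSide (F.P K).L M (RkOfRecord (F.P K).L ν.r (g i)) i ∣ (F.P K).sitesPerDir 0) (lamDatum F) (dataSmall7LamTopOf F 2) B₃ B₃' a₀ a₁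

/-- THE ONE β-family of the print-regime Z3 members: `β₁₃(F; a₀, ε₂₉)` (letter census `betaOfRecord₁₃_zbRegime_letterBlind`: every other letter is unread). -/
noncomputable def betaZB (a₀ ε₂₉ : ℝ) : HBeta :=
  betaOfRecord₁₃ F 2 (theta13OfThm1CCMWZB F 2 0 (1 / 2) a₀ 0 ε₂₉ 0 0 a₀ 0 (fun _ _ => 0) (fun _ _ => 0))

theorem betaOfRecord₁₃_eq_betaZB (j : ℕ) (a₀ ε₀ ε₂₉ B₃ B₃' a₁ : ℝ) (Efl logz : B12.RunParams → ℕ → ℝ) :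
    betaOfRecord₁₃ F 2 (theta13OfThm1CCMWZB F 2 j (1 / 2) a₀ ε₀ ε₂₉ B₃ B₃' a₀ a₁ Efl logz) = betaZB F a₀ ε₂₉ :=
  betaOfRecord₁₃_zbRegime_letterBlind F j 0 a₀ ε₀ 0 ε₂₉ B₃ 0 B₃' 0 a₁ 0 Efl logz (fun _ _ => 0) (fun _ _ => 0)

/-- The box owed at radius `a₀` (the uniform core's conclusion, verbatim). -/
def BoxZB (a₀ : ℝ) : Prop :=
  ∃ γ₀ ε₂₉ β' : ℝ, 0 < γ₀ ∧ 0 < ε₂₉ ∧ ∀ (j : ℕ) (ε₀ B₃ B₃' a₁ : ℝ) (Efl logz : B12.RunParams → ℕ → ℝ),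
    BetaLowerH (-β') γ₀ (betaOfRecord₁₃ F 2 (theta13OfThm1CCMWZB F 2 j (1 / 2) a₀ ε₀ ε₂₉ B₃ B₃' a₀ a₁ Efl logz)) ∧
    BetaUpperH β' γ₀ (betaOfRecord₁₃ F 2 (theta13OfThm1CCMWZB F 2 j (1 / 2) a₀ ε₀ ε₂₉ B₃ B₃' a₀ a₁ Efl logz))

/-- 2′ IS «box owed at every positive radius carrying the antecedents» (the tree's uniform core, re-lettered). -/
theorem twoPrime_iff_core : AbsBetaBoxAtThm1WitnessCCMGenGridGZBAt F ↔ ∀ a₀ : ℝ, 0 < a₀ → AnteZB F a₀ → BoxZB F a₀ :=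
  absBetaBoxGZBAt_iff_uniformZB F

theorem anteZB_anti {a a' : ℝ} (hle : a ≤ a') (h : AnteZB F a') : AnteZB F a := by
  obtain ⟨j, c, c₀, c₁, B₃, B₃', a₁, hc, hc₀, hc₁, hB, hB', ha₁, h8, h9⟩ := h
  exact ⟨j, c, c₀, c₁, B₃, B₃', a₁, hc, hc₀, hc₁, hB, hB', ha₁, variationalThm1RegSepCoP7MGB_anti hle h8, gauge9RegSepTopStepGB_anti hle h9⟩

/-- **PIECE (W) — tagged WEAKER-mod-certificate**: the box is owed only at radii `≤ ā`, and the producer certifies its `ε₂₉` (`Cert a₀ ε₂₉`, e.g. the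
threshold ordering `8·ε₂₉ ≤ …` print's (2.9) letter obeys).  With `Cert := ⊤` this is literally 2′ restricted to `(0, ā]`. -/
def BoxOwedBelow (ā : ℝ) (Cert : ℝ → ℝ → Prop) : Prop :=
  ∀ a₀ : ℝ, 0 < a₀ → a₀ ≤ ā → AnteZB F a₀ →
    ∃ γ₀ ε₂₉ β' : ℝ, 0 < γ₀ ∧ 0 < ε₂₉ ∧ Cert a₀ ε₂₉ ∧ BetaLowerH (-β') γ₀ (betaZB F a₀ ε₂₉) ∧ BetaUpperH β' γ₀ (betaZB F a₀ ε₂₉)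

/-- **PIECE (T) — tagged ATTACKABLE (card `radius-collapse-choice-rigid-k0`)**: above `ā` the β-family does not read the radius letter. -/
def RadiusBlindAbove (ā : ℝ) (Cert : ℝ → ℝ → Prop) : Prop :=
  ∀ a₀ ε₂₉ : ℝ, ā < a₀ → AnteZB F a₀ → Cert ā ε₂₉ → betaZB F a₀ ε₂₉ = betaZB F ā ε₂₉

/-- **THE NODE's composition** (kernel-checked): (W) ∧ (T) ⇒ the uniform core. -/
theorem core_of_pieces {ā : ℝ} (hā : 0 < ā) (Cert : ℝ → ℝ → Prop) (hW : BoxOwedBelow F ā Cert) (hT : RadiusBlindAbove F ā Cert) :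
    ∀ a₀ : ℝ, 0 < a₀ → AnteZB F a₀ → BoxZB F a₀ := by
  intro a₀ ha₀ hA
  by_cases hle : a₀ ≤ ā
  · obtain ⟨γ₀, ε₂₉, β', hγ, hε, -, hlo, hup⟩ := hW a₀ ha₀ hle hA
    refine ⟨γ₀, ε₂₉, β', hγ, hε, fun j ε₀ B₃ B₃' a₁ Efl logz => ?_⟩
    rw [betaOfRecord₁₃_eq_betaZB]
    exact ⟨hlo, hup⟩
  · rw [not_le] at hle
    obtain ⟨γ₀, ε₂₉, β', hγ, hε, hc, hlo, hup⟩ := hW ā hā le_rfl (anteZB_anti F hle.le hA)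
    have heq : betaZB F a₀ ε₂₉ = betaZB F ā ε₂₉ := hT a₀ ε₂₉ hle hA hc
    refine ⟨γ₀, ε₂₉, β', hγ, hε, fun j ε₀ B₃ B₃' a₁ Efl logz => ?_⟩
    rw [betaOfRecord₁₃_eq_betaZB, heq]
    exact ⟨hlo, hup⟩

/-- **… and hence 2′ BY NAME** (`K0V23Defs.AbsBetaBoxAtThm1WitnessCCMGenGridGZBAt F`). -/
theorem twoPrime_of_pieces {ā : ℝ} (hā : 0 < ā) (Cert : ℝ → ℝ → Prop) (hW : BoxOwedBelow F ā Cert) (hT : RadiusBlindAbove F ā Cert) :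
    AbsBetaBoxAtThm1WitnessCCMGenGridGZBAt F :=
  (twoPrime_iff_core F).2 (core_of_pieces F hā Cert hW hT)

end Node

/-! ## §4  The two idea stubs (FIRST LEMMAS of the cards; `sorry` only here) -/

section Stubs

variable (F : T4Family)

/-- **stub (card radius-collapse-choice-rigid-k0) — β READS THE RADIUS LETTER ONLY THROUGH THE SELECTORS ON THE REGULAR FIELDS**: if the background selectors
of record at radii `a`, `a′` agree on the `r`-regular fields of every level and torus, and the (2.9) letter is below the regularity threshold (`8·ε₂₉ ≤ r`,
so that every base field the merged term (1.6) and the small-field actions `A_j` READ is `r`-regular — the read-set induction of the card), then the two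
print-regime Z3 β-families coincide AS FUNCTIONS.  Route: read-set induction on `effActionHT`'s recursion + base-locality of `TcanOfRecord` + germ-locality
of `polComp` at the flat configuration.  Size L. -/
theorem stub_beta13_radiusBlind (a a' ε₂₉ r : ℝ) (hε : 0 < ε₂₉) (hr : 8 * ε₂₉ ≤ r)
    (hU : SelectorsAgreeOn F 2 a a' r) : betaZB F a ε₂₉ = betaZB F a' ε₂₉ := by
  sorry

/-- **stub (card near-sheet-rider-k0) — THE p.267 RIDER AS A GLOBAL LEMMA ON THE GUARDED FIBRE**: there are `C, c > 0` (depending on `F.L`, `N` only —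
`C ≍ L^{d−1}`) such that on the fibre `{Ū V = Ū V}` over a solvable, `δ`-regular critical configuration, the printed (2.9) cutoff (`χ^{(2.9)}_k(V) = 1`:
all NON-distinguished fluctuation variables `< ε₁`) forces the DISTINGUISHED ones `B′(b₀(c))` to be `≤ C·ε₁` — globally on the fibre, not only in
print's linear chart (`B12B0Restriction267.norm_apply_b0_le` is the linear level).  Mechanism: `BlockAveraging.corr`'s axial default OFF the `Small`
domain leaves no far sheet, and ON it the guarded exp-mean-log average is `L^{1−d}`-monotone in the `b₀` variable.  Size M. -/
theorem stub_fluctDev_b0_le_on_fibre (N : ℕ) [NeZero N] : ∃ C c : ℝ, 0 < C ∧ 0 < c ∧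
    ∀ (ν : Stage7Numerics) (ε₁ δ : ℝ) (K k : ℕ) (V : GaugeField (F.P K) k (SU N)),
      0 < ε₁ → ε₁ ≤ c → 0 ≤ δ → δ ≤ c →
      UkExists F N K (k + 1) ν.εreg ((avOfRecord F N K k).avg V) →
      PlaqSmall δ (critCfgOfRecord F N ν K k ((avOfRecord F N K k).avg V)) →
      chiFix29OfRecord F N ν ε₁ K k V = 1 →
      ∀ b : PBond (F.P K) k, IsB0 b → fluctDevOfRecord F N ν K k V b ≤ C * ε₁ := by
  sorry

/-- Consequence offered to the read-set induction (proved from the stub + the tree's `mem_domAltOfRecord_of_chiFix29_eq_one`): on such fibres the support of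
the PRINTED (2.9) cutoff lies in the second-form small-field domain of record `{|∂V − 1| < ν.ε₀}` once `δ + 4·max(ε₁, C·ε₁) ≤ ν.ε₀`. -/
theorem mem_domAlt_of_chiFix29_of_stub {N : ℕ} [NeZero N] {C c : ℝ}
    (hstub : ∀ (ν : Stage7Numerics) (ε₁ δ : ℝ) (K k : ℕ) (V : GaugeField (F.P K) k (SU N)),
      0 < ε₁ → ε₁ ≤ c → 0 ≤ δ → δ ≤ c →
      UkExists F N K (k + 1) ν.εreg ((avOfRecord F N K k).avg V) →
      PlaqSmall δ (critCfgOfRecord F N ν K k ((avOfRecord F N K k).avg V)) →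
      chiFix29OfRecord F N ν ε₁ K k V = 1 →
      ∀ b : PBond (F.P K) k, IsB0 b → fluctDevOfRecord F N ν K k V b ≤ C * ε₁)
    {ν : Stage7Numerics} {ε₁ δ : ℝ} {K k : ℕ} {V : GaugeField (F.P K) k (SU N)}
    (hε₁ : 0 < ε₁) (hε₁c : ε₁ ≤ c) (hδ : 0 ≤ δ) (hδc : δ ≤ c)
    (hex : UkExists F N K (k + 1) ν.εreg ((avOfRecord F N K k).avg V))
    (hcrit : PlaqSmall δ (critCfgOfRecord F N ν K k ((avOfRecord F N K k).avg V)))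
    (hχ : chiFix29OfRecord F N ν ε₁ K k V = 1) (hord : δ + 4 * max ε₁ (C * ε₁) ≤ ν.ε₀) :
    V ∈ domAltOfRecord F N ν K k :=
  mem_domAltOfRecord_of_chiFix29_eq_one hχ (hstub ν ε₁ δ K k V hε₁ hε₁c hδ hδc hex hcrit hχ) hcrit hord

end Stubs

end Summit.QuantumFields.YangMills.Cruxes.Record13SepCoPHInhabited.RadiusCollapse
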